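import Literature.AlgebraicGeometry.Motives.UniversalHyperplaneSectionChart
import HarnessLib

/-!
# The chart rings of Jouanolou's torsor: `Γ(X') ⊗ₖ (k[a]_{(a_l)})₀` localised at the incidence function

Topic `Literature/AlgebraicGeometry/Motives`; definitions + theorems (pure commutative algebra), no
named facts. Second file of the discharge of `jouanolou_affineTorsor` (Jouanolou 1973, Lemme 1.5)
through the incidence-complement model `Y = {(x, a) | Σᵢ aᵢ xᵢ(x) ≠ 0} ⊆ X ×ₖ (ℙᴺ)^*`
(`Motives/JouanolouTorsor`).

Fix `ι : X ⟶ ℙᴺ_k`, a chart index `j` and an affine open `X' ⊆ ι⁻¹ D₊(x_j)` with ring `B = Γ(X, X')`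
and coordinates `uᵢ = ι^*(xᵢ/x_j)|_{X'} ∈ B` (`UniversalHyperplaneSection.secCoord`, `u_j = 1`). The
piece `π⁻¹ X'` of Jouanolou's torsor is to be identified with `X' × 𝔸ᴺ = Spec B[t₁, …, t_N]`
(`chartSrcRing`) through the **moving hyperplane**

  `a = (a₀ : … : a_N)`,  `aᵢ = tᵢ'` for `i = j.succAbove i'`,  `a_j = 1 - Σ_{i'} u_{j.succAbove i'} tᵢ'`

(`hypVec`), the unique normalisation with `Σᵢ uᵢ aᵢ = 1` (`sum_secCoord_mul_hypVec`): the point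
`(x, t) ∈ X' × 𝔸ᴺ` goes to `(x, [a(x,t)])`, a hyperplane not through `ι(x)`. Over the standard chart
`D₊(a_l)` of `(ℙᴺ)^*`, i.e. on the affine chart `X' ×ₖ D₊(a_l) = Spec (B ⊗ₖ (k[a]_{(a_l)})₀)` of
`X ×ₖ (ℙᴺ)^*` (`UniversalHyperplaneSection.chartImm`), where the incidence locus is `{g_l = 0}`,
`g_l = Σᵢ uᵢ ⊗ aᵢ/a_l` (`UniversalHyperplaneSection.incidenceFun`,
`preimage_chartImm_incidenceLocus`), this identification is the ring map

  `ρ_l : B ⊗ₖ (k[a]_{(a_l)})₀ → B[t][a_l⁻¹]`,  `b ⊗ 1 ↦ b`,  `1 ⊗ aᵢ/a_l ↦ aᵢ · a_l⁻¹`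

(`chartHom`), and the main result of this file is that **`ρ_l` is the localisation of
`B ⊗ₖ (k[a]_{(a_l)})₀` at `g_l`**: `ρ_l (g_l) = a_l⁻¹` (`chartHom_incidenceFun`) and `ρ_l` induces a
ring isomorphism `(B ⊗ₖ (k[a]_{(a_l)})₀)[g_l⁻¹] ≅ B[t][a_l⁻¹]` (`locEquiv`, `locEquiv_comp_algebraMap`,
`isLocalization_away_chartHom`), with inverse `tᵢ' ↦ (1 ⊗ a_{j.succAbove i'}/a_l) · g_l⁻¹`.
Geometrically: `π⁻¹ X' ∩ (X' × D₊(a_l)) = {g_l ≠ 0}` is the open `{a_l ≠ 0}` of `X' × 𝔸ᴺ` — the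
gluing step of Jouanolou's affine-space bundle structure (the sequel `Motives/JouanolouTorsorChart`
turns this into the open immersion `X' × 𝔸ᴺ ↪ Y` with image `π⁻¹ X'`).

Also here: the ring map `(k[a]_{(a_l)})₀ → B[t][a_l⁻¹]`, `aᵢ/a_l ↦ aᵢ a_l⁻¹` (`dualChartHom`) and an
extensionality principle for ring maps out of the chart rings `(k[x]_{(x_a)})₀` of projective space
(`Segre.ringHom_ext_away`: determined by the constants and the `x_c/x_a`).

## References

* J.-P. Jouanolou, *Une suite exacte de Mayer–Vietoris en K-théorie algébrique*, LNM 341 (1973),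
  Lemme 1.5. [Jouanolou1973]
* R. Hartshorne, *Algebraic Geometry* (1977): II Prop. 2.5 (b) and its proof (the rings
  `S_{(f)}`), II Thm. 7.1 (proof: `x_i/x_l ↦ s_i/s_l`). [Hartshorne1977]
-/

noncomputable section

open CategoryTheory AlgebraicGeometry HomogeneousLocalization TopologicalSpace
open scoped TensorProduct

universe u

namespace Literature.AlgebraicGeometry.Motives

-- `MvPolynomial.gradedAlgebra` is a `def` in Mathlib (no global instance), cf. `Motives/SegreEmbedding`.
attribute [local instance] MvPolynomial.gradedAlgebra

/-! ### Ring maps out of the chart rings `(k[x]_{(x_a)})₀` of projective space -/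

namespace Segre

variable {ι : Type} (k : Type u) [CommRing k] {S : Type*} [CommRing S]

/-- **Extensionality for ring maps out of `(k[x]_{(x_a)})₀`**: such a map is determined by its values on
the constants and on the coordinate functions `x_c/x_a` (every element is a polynomial in the
`x_c/x_a`, `Segre.awayMk_eq_eval₂`; Hartshorne II Prop. 2.5 (b), proof: `S_{(f)}` is generated by the
`x_c/x_a`). [cite: Hartshorne1977, II Prop. 2.5 (b) (proof)] -/
theorem ringHom_ext_away (a : ι) {θ₁ θ₂ : Away (grading ι k) (MvPolynomial.X a) →+* S}
    (hc : θ₁.comp (cst k (MvPolynomial.X a)) = θ₂.comp (cst k (MvPolynomial.X a)))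
    (hf : ∀ c, θ₁ (frac k a c) = θ₂ (frac k a c)) : θ₁ = θ₂ := by
  ext z
  obtain ⟨n, p, hp, rfl⟩ := Away.mk_surjective (grading ι k) (X_mem k a) z
  rw [awayMk_eq_eval₂, ← RingHom.comp_apply, ← RingHom.comp_apply, MvPolynomial.comp_eval₂Hom,
    MvPolynomial.comp_eval₂Hom, hc]
  congr 2
  funext c
  exact hf c

end Segre

namespace JouanolouTorsor

open UniversalHyperplaneSection

variable {k : Type u} [Field k] {N : ℕ} {X : SchemeOver k} (ι : X ⟶ projectiveSpace N k)
  (j : Fin (N + 1)) (X' : X.left.affineOpens)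

attribute [local instance] UniversalHyperplaneSection.chartBaseRingAlgebra
  UniversalHyperplaneSection.sectionsAlgebra

/-! ### The coordinate ring `B[t₁, …, t_N]` of `X' × 𝔸ᴺ` and the moving hyperplane -/

variable (N) in
/-- The coordinate ring `B[t₁, …, t_N]` of `X' ×ₖ 𝔸ᴺ`, `B = Γ(X, X')`. [cite: Jouanolou1973, Lemme 1.5] -/
abbrev chartSrcRing : Type u := MvPolynomial (Fin N) Γ(X.left, (X' : X.left.Opens))

variable (hX' : (X' : X.left.Opens) ≤ ι.left ⁻¹ᵁ Proj.basicOpen (Segre.grading (Fin (N + 1)) k) (MvPolynomial.X j))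

/-- **The moving hyperplane** `a = (a₀ : … : a_N)` over `X' × 𝔸ᴺ`: `aᵢ = tᵢ'` for `i = j.succAbove i'`
and `a_j = 1 - Σ_{i'} u_{j.succAbove i'} tᵢ'`, so that `Σᵢ uᵢ aᵢ = 1` — the hyperplane `[a]` never
passes through `ι(x) = [u(x)]`. [cite: Jouanolou1973, Lemme 1.5] -/
def hypVec : Fin (N + 1) → chartSrcRing N X' :=
  Fin.insertNth (α := fun _ => chartSrcRing N X') j
    (1 - ∑ i' : Fin N, MvPolynomial.C (secCoord ι j X' hX' (j.succAbove i')) * MvPolynomial.X i') (fun i' => MvPolynomial.X i')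

/-- `a_j = 1 - Σ_{i'} u_{j.succAbove i'} tᵢ'`. [cite: Jouanolou1973, Lemme 1.5] -/
theorem hypVec_self :
    hypVec ι j X' hX' j = 1 - ∑ i' : Fin N, MvPolynomial.C (secCoord ι j X' hX' (j.succAbove i')) * MvPolynomial.X i' := by
  simp [hypVec]

/-- `a_{j.succAbove i'} = tᵢ'`. [cite: Jouanolou1973, Lemme 1.5] -/
@[simp]
theorem hypVec_succAbove (i' : Fin N) : hypVec ι j X' hX' (j.succAbove i') = MvPolynomial.X i' := by
  simp [hypVec]

/-- **The normalisation `Σᵢ uᵢ aᵢ = 1`** (with `u_j = 1`). [cite: Jouanolou1973, Lemme 1.5] -/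
theorem sum_secCoord_mul_hypVec :
    ∑ i : Fin (N + 1), MvPolynomial.C (secCoord ι j X' hX' i) * hypVec ι j X' hX' i = 1 := by
  rw [Fin.sum_univ_succAbove _ j, hypVec_self, secCoord_self, map_one, one_mul]
  simp only [hypVec_succAbove, sub_add_cancel]

/-- The `aᵢ` generate the unit ideal of `B[t]`. [cite: Jouanolou1973, Lemme 1.5] -/
theorem span_range_hypVec : Ideal.span (Set.range (hypVec ι j X' hX')) = ⊤ := by
  rw [Ideal.eq_top_iff_one, ← sum_secCoord_mul_hypVec ι j X' hX']
  exact Ideal.sum_mem _ fun i _ ↦ Ideal.mul_mem_left _ _ (Ideal.subset_span ⟨i, rfl⟩)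

/-! ### The rings `B[t][a_l⁻¹]` and the maps `(k[a]_{(a_l)})₀ → B[t][a_l⁻¹]` -/

section Loc

variable (l : Fin (N + 1))

/-- The ring `B[t][a_l⁻¹]` of the open `{a_l ≠ 0} ⊆ X' × 𝔸ᴺ` (the part of `π⁻¹X'` over the chart
`D₊(a_l)` of `(ℙᴺ)^*`). [cite: Jouanolou1973, Lemme 1.5] -/
abbrev locRing : Type u := Localization.Away (hypVec ι j X' hX' l)

/-- `a_l` is a unit of `B[t][a_l⁻¹]`.
[cite: Jouanolou1973, Lemme 1.5] -/
theorem isUnit_algebraMap_hypVec :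
    IsUnit (algebraMap (chartSrcRing N X') (locRing ι j X' hX' l) (hypVec ι j X' hX' l)) :=
  IsLocalization.Away.algebraMap_isUnit _

/-- The inverse `a_l⁻¹ ∈ B[t][a_l⁻¹]`. [cite: Jouanolou1973, Lemme 1.5] -/
def invHyp : locRing ι j X' hX' l := ↑(isUnit_algebraMap_hypVec ι j X' hX' l).unit⁻¹

/-- `a_l · a_l⁻¹ = 1`.
[cite: Jouanolou1973, Lemme 1.5] -/
@[simp]
theorem algebraMap_hypVec_mul_invHyp :
    algebraMap (chartSrcRing N X') (locRing ι j X' hX' l) (hypVec ι j X' hX' l) * invHyp ι j X' hX' l = 1 :=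
  (isUnit_algebraMap_hypVec ι j X' hX' l).mul_val_inv

/-- `a_l⁻¹ · a_l = 1`.
[cite: Jouanolou1973, Lemme 1.5] -/
@[simp]
theorem invHyp_mul_algebraMap_hypVec :
    invHyp ι j X' hX' l * algebraMap (chartSrcRing N X') (locRing ι j X' hX' l) (hypVec ι j X' hX' l) = 1 :=
  (isUnit_algebraMap_hypVec ι j X' hX' l).val_inv_mul

/-- The evaluation `k[a₀, …, a_N] → B[t][a_l⁻¹]`, `aᵢ ↦ aᵢ · a_l⁻¹` (so `a_l ↦ 1`): the numerators of
Hartshorne's chart map `x_i/x_l ↦ s_i/s_l` for the sections `sᵢ = aᵢ`.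
[cite: Hartshorne1977, II Thm. 7.1 (proof)] -/
def evalRatio : MvPolynomial (Fin (N + 1)) k →+* locRing ι j X' hX' l :=
  MvPolynomial.eval₂Hom (algebraMap k (locRing ι j X' hX' l))
    (fun i ↦ algebraMap (chartSrcRing N X') (locRing ι j X' hX' l) (hypVec ι j X' hX' i) *
      invHyp ι j X' hX' l)

/-- `evalRatio` on a variable. [cite: Hartshorne1977, II Thm. 7.1 (proof)] -/
@[simp]
theorem evalRatio_X (i : Fin (N + 1)) :
    evalRatio ι j X' hX' l (MvPolynomial.X i) =
      algebraMap (chartSrcRing N X') (locRing ι j X' hX' l) (hypVec ι j X' hX' i) * invHyp ι j X' hX' l := by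
  simp [evalRatio]

/-- `evalRatio` on a constant. [cite: Hartshorne1977, II Thm. 7.1 (proof)] -/
@[simp]
theorem evalRatio_C (c : k) :
    evalRatio ι j X' hX' l (MvPolynomial.C c) = algebraMap k (locRing ι j X' hX' l) c := by
  simp [evalRatio]

/-- `evalRatio (a_l) = 1`. [cite: Hartshorne1977, II Thm. 7.1 (proof)] -/
theorem evalRatio_X_self : evalRatio ι j X' hX' l (MvPolynomial.X l) = 1 := by
  rw [evalRatio_X, algebraMap_hypVec_mul_invHyp]

/-- `evalRatio (a_l)` is a unit.
[cite: Jouanolou1973, Lemme 1.5] -/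
theorem isUnit_evalRatio_X_self : IsUnit (evalRatio ι j X' hX' l (MvPolynomial.X l)) := by
  rw [evalRatio_X_self]
  exact isUnit_one

/-- **The chart ring map of the dual projective space** `(k[a]_{(a_l)})₀ → B[t][a_l⁻¹]`,
`aᵢ/a_l ↦ aᵢ · a_l⁻¹` (Hartshorne II Thm. 7.1, proof, for the sections `aᵢ` of `𝒪`).
[cite: Hartshorne1977, II Thm. 7.1 (proof)] -/
def dualChartHom : chartBaseRing (k := k) N l →+* locRing ι j X' hX' l :=
  (Localization.awayLift (evalRatio ι j X' hX' l) (MvPolynomial.X l) (isUnit_evalRatio_X_self ι j X' hX' l)).comp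
    (algebraMap (chartBaseRing (k := k) N l) (Localization.Away (MvPolynomial.X l : MvPolynomial (Fin (N + 1)) k)))

/-- `dualChartHom (p / a_l^n) = evalRatio p` for `p` homogeneous of degree `n`.
[cite: Hartshorne1977, II Thm. 7.1 (proof)] -/
theorem dualChartHom_awayMk (n : ℕ) (p : MvPolynomial (Fin (N + 1)) k) (hp : p ∈ Segre.grading (Fin (N + 1)) k (n • 1)) :
    dualChartHom ι j X' hX' l (Away.mk _ (Segre.X_mem k l) n p hp) = evalRatio ι j X' hX' l p := by
  simp only [dualChartHom, RingHom.comp_apply, HomogeneousLocalization.algebraMap_apply, Away.val_mk]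
  rw [Localization.awayLift_mk (evalRatio ι j X' hX' l) (MvPolynomial.X l) p 1
    (by rw [evalRatio_X_self, mul_one]) n, one_pow, mul_one]

/-- `dualChartHom (aᵢ/a_l) = aᵢ · a_l⁻¹`. [cite: Hartshorne1977, II Thm. 7.1 (proof)] -/
@[simp]
theorem dualChartHom_frac (i : Fin (N + 1)) :
    dualChartHom ι j X' hX' l (Segre.frac k l i) =
      algebraMap (chartSrcRing N X') (locRing ι j X' hX' l) (hypVec ι j X' hX' i) * invHyp ι j X' hX' l := by
  rw [show Segre.frac k l i = Away.mk _ (Segre.X_mem k l) 1 (MvPolynomial.X i ^ 1) (by simpa using Segre.X_mem k i)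
    from rfl, dualChartHom_awayMk, pow_one, evalRatio_X]

/-- `dualChartHom` is a `k`-algebra map: on constants it is the structure map.
[cite: Hartshorne1977, II Thm. 7.1 (proof)] -/
theorem dualChartHom_comp_cst :
    (dualChartHom ι j X' hX' l).comp (Segre.cst k (MvPolynomial.X l)) = algebraMap k (locRing ι j X' hX' l) := by
  ext c
  simp only [dualChartHom, RingHom.comp_apply, HomogeneousLocalization.algebraMap_apply, Segre.val_cst]
  rw [IsLocalization.Away.lift_eq]
  exact evalRatio_C ι j X' hX' l c

/-- `dualChartHom` on a constant. [cite: Hartshorne1977, II Thm. 7.1 (proof)] -/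
@[simp]
theorem dualChartHom_cst (c : k) :
    dualChartHom ι j X' hX' l (Segre.cst k (MvPolynomial.X l) c) = algebraMap k (locRing ι j X' hX' l) c := by
  rw [← RingHom.comp_apply, dualChartHom_comp_cst]

/-! ### The ring map `ρ_l : B ⊗ₖ (k[a]_{(a_l)})₀ → B[t][a_l⁻¹]` -/

/-- `B → B[t][a_l⁻¹]` as a `k`-algebra map.
[cite: Jouanolou1973, Lemme 1.5] -/
def leftAlgHom : Γ(X.left, (X' : X.left.Opens)) →ₐ[k] locRing ι j X' hX' l where
  toRingHom := (algebraMap (chartSrcRing N X') (locRing ι j X' hX' l)).comp MvPolynomial.C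
  commutes' c := by
    change algebraMap (chartSrcRing N X') (locRing ι j X' hX' l)
      (MvPolynomial.C (algebraMap k Γ(X.left, (X' : X.left.Opens)) c)) = _
    rw [← MvPolynomial.algebraMap_eq, ← IsScalarTower.algebraMap_apply, ← IsScalarTower.algebraMap_apply]

/-- `leftAlgHom b = b` (as a constant polynomial, in the localisation).
[cite: Jouanolou1973, Lemme 1.5] -/
@[simp]
theorem leftAlgHom_apply (b : Γ(X.left, (X' : X.left.Opens))) :
    leftAlgHom ι j X' hX' l b = algebraMap (chartSrcRing N X') (locRing ι j X' hX' l) (MvPolynomial.C b) :=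
  rfl

/-- `(k[a]_{(a_l)})₀ → B[t][a_l⁻¹]` as a `k`-algebra map. [cite: Hartshorne1977, II Thm. 7.1 (proof)] -/
def dualChartAlgHom : chartBaseRing (k := k) N l →ₐ[k] locRing ι j X' hX' l where
  toRingHom := dualChartHom ι j X' hX' l
  commutes' c := dualChartHom_cst ι j X' hX' l c

/-- `dualChartAlgHom` is `dualChartHom` on elements.
[cite: Jouanolou1973, Lemme 1.5] -/
@[simp]
theorem dualChartAlgHom_apply (r : chartBaseRing (k := k) N l) :
    dualChartAlgHom ι j X' hX' l r = dualChartHom ι j X' hX' l r := rfl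

/-- **The chart ring map `ρ_l : B ⊗ₖ (k[a]_{(a_l)})₀ → B[t][a_l⁻¹]`**, `b ⊗ (aᵢ/a_l) ↦ b · aᵢ · a_l⁻¹`:
the ring map of `{a_l ≠ 0} ⊆ X' × 𝔸ᴺ → X' ×ₖ D₊(a_l)`, `(x, t) ↦ (x, [a(x, t)])`.
[cite: Jouanolou1973, Lemme 1.5] -/
def chartHom : chartRing (X := X) l X' →+* locRing ι j X' hX' l :=
  (Algebra.TensorProduct.lift (leftAlgHom ι j X' hX' l) (dualChartAlgHom ι j X' hX' l)
    (fun _ _ ↦ Commute.all _ _)).toRingHom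

/-- `ρ_l (b ⊗ r) = b · dualChartHom r`. [cite: Jouanolou1973, Lemme 1.5] -/
@[simp]
theorem chartHom_tmul (b : Γ(X.left, (X' : X.left.Opens))) (r : chartBaseRing (k := k) N l) :
    chartHom ι j X' hX' l (b ⊗ₜ[k] r) =
      algebraMap (chartSrcRing N X') (locRing ι j X' hX' l) (MvPolynomial.C b) * dualChartHom ι j X' hX' l r := by
  simp [chartHom]

/-- **`ρ_l` inverts the incidence function**: `ρ_l (g_l) · a_l = 1`, `g_l = Σᵢ uᵢ ⊗ aᵢ/a_l` — because
`Σᵢ uᵢ aᵢ = 1`. [cite: Jouanolou1973, Lemme 1.5] -/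
theorem chartHom_incidenceFun_mul :
    chartHom ι j X' hX' l (incidenceFun ι j l X' hX') *
        algebraMap (chartSrcRing N X') (locRing ι j X' hX' l) (hypVec ι j X' hX' l) = 1 := by
  have h := congrArg (algebraMap (chartSrcRing N X') (locRing ι j X' hX' l))
    (sum_secCoord_mul_hypVec ι j X' hX')
  rw [map_one, map_sum] at h
  rw [incidenceFun, map_sum, Finset.sum_mul, ← h]
  refine Finset.sum_congr rfl fun i _ ↦ ?_
  rw [chartHom_tmul, dualChartHom_frac, map_mul, mul_assoc, mul_assoc, invHyp_mul_algebraMap_hypVec,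
    mul_one]

/-- `ρ_l (g_l) = a_l⁻¹`. [cite: Jouanolou1973, Lemme 1.5] -/
theorem chartHom_incidenceFun :
    chartHom ι j X' hX' l (incidenceFun ι j l X' hX') = invHyp ι j X' hX' l := by
  have h := chartHom_incidenceFun_mul ι j X' hX' l
  calc chartHom ι j X' hX' l (incidenceFun ι j l X' hX')
      = chartHom ι j X' hX' l (incidenceFun ι j l X' hX') *
          (algebraMap (chartSrcRing N X') (locRing ι j X' hX' l) (hypVec ι j X' hX' l) *
            invHyp ι j X' hX' l) := by rw [algebraMap_hypVec_mul_invHyp, mul_one]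
    _ = invHyp ι j X' hX' l := by rw [← mul_assoc, h, one_mul]

/-- `ρ_l (g_l)` is a unit. [cite: Jouanolou1973, Lemme 1.5] -/
theorem isUnit_chartHom_incidenceFun : IsUnit (chartHom ι j X' hX' l (incidenceFun ι j l X' hX')) := by
  rw [chartHom_incidenceFun]
  exact Units.isUnit _

/-! ### The inverse `B[t][a_l⁻¹] → (B ⊗ₖ (k[a]_{(a_l)})₀)[g_l⁻¹]` -/

/-- The localisation `(B ⊗ₖ (k[a]_{(a_l)})₀)[g_l⁻¹]` — the ring of the open `{g_l ≠ 0}` of the chart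
`X' ×ₖ D₊(a_l)`, i.e. of `π⁻¹X' ∩ (X' × D₊(a_l))`. [cite: Jouanolou1973, Lemme 1.5] -/
abbrev incLocRing : Type u := Localization.Away (incidenceFun ι j l X' hX')

/-- `g_l` is a unit of `(B ⊗ R_l)[g_l⁻¹]`.
[cite: Jouanolou1973, Lemme 1.5] -/
theorem isUnit_algebraMap_incidenceFun :
    IsUnit (algebraMap (chartRing (X := X) l X') (incLocRing ι j X' hX' l) (incidenceFun ι j l X' hX')) :=
  IsLocalization.Away.algebraMap_isUnit _

/-- The inverse `g_l⁻¹ ∈ (B ⊗ R_l)[g_l⁻¹]`.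
[cite: Jouanolou1973, Lemme 1.5] -/
def invInc : incLocRing ι j X' hX' l := ↑(isUnit_algebraMap_incidenceFun ι j X' hX' l).unit⁻¹

/-- `g_l · g_l⁻¹ = 1`.
[cite: Jouanolou1973, Lemme 1.5] -/
@[simp]
theorem algebraMap_incidenceFun_mul_invInc :
    algebraMap (chartRing (X := X) l X') (incLocRing ι j X' hX' l) (incidenceFun ι j l X' hX') *
      invInc ι j X' hX' l = 1 :=
  (isUnit_algebraMap_incidenceFun ι j X' hX' l).mul_val_inv

/-- `g_l⁻¹ · g_l = 1`.
[cite: Jouanolou1973, Lemme 1.5] -/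
@[simp]
theorem invInc_mul_algebraMap_incidenceFun :
    invInc ι j X' hX' l *
      algebraMap (chartRing (X := X) l X') (incLocRing ι j X' hX' l) (incidenceFun ι j l X' hX') = 1 :=
  (isUnit_algebraMap_incidenceFun ι j X' hX' l).val_inv_mul

/-- The element `(1 ⊗ aᵢ/a_l) · g_l⁻¹` of `(B ⊗ R_l)[g_l⁻¹]` — the image of `aᵢ` under the inverse
chart map. [cite: Jouanolou1973, Lemme 1.5] -/
def fracInc (i : Fin (N + 1)) : incLocRing ι j X' hX' l :=
  algebraMap (chartRing (X := X) l X') (incLocRing ι j X' hX' l)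
      ((1 : Γ(X.left, (X' : X.left.Opens))) ⊗ₜ[k] Segre.frac k l i) * invInc ι j X' hX' l

/-- The inverse chart map on `B[t]`: `b ↦ b ⊗ 1`, `tᵢ' ↦ (1 ⊗ a_{j.succAbove i'}/a_l) · g_l⁻¹`.
[cite: Jouanolou1973, Lemme 1.5] -/
def invPolyHom : chartSrcRing N X' →+* incLocRing ι j X' hX' l :=
  MvPolynomial.eval₂Hom ((algebraMap (chartRing (X := X) l X') (incLocRing ι j X' hX' l)).comp
      Algebra.TensorProduct.includeLeftRingHom)
    (fun i' ↦ fracInc ι j X' hX' l (j.succAbove i'))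

/-- `invPolyHom` on constants.
[cite: Jouanolou1973, Lemme 1.5] -/
@[simp]
theorem invPolyHom_C (b : Γ(X.left, (X' : X.left.Opens))) :
    invPolyHom ι j X' hX' l (MvPolynomial.C b) =
      algebraMap (chartRing (X := X) l X') (incLocRing ι j X' hX' l) (b ⊗ₜ[k] 1) := by
  simp [invPolyHom, Algebra.TensorProduct.includeLeftRingHom]

/-- `invPolyHom` on variables.
[cite: Jouanolou1973, Lemme 1.5] -/
@[simp]
theorem invPolyHom_X (i' : Fin N) :
    invPolyHom ι j X' hX' l (MvPolynomial.X i') = fracInc ι j X' hX' l (j.succAbove i') := by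
  simp [invPolyHom]

/-- **The inverse chart map sends every `aᵢ` to `(1 ⊗ aᵢ/a_l) · g_l⁻¹`** (for `i = j` this is the
identity `1 - Σ_{i'} (u ⊗ a/a_l) g⁻¹ = (1 ⊗ a_j/a_l) g⁻¹`, i.e. `g = 1 ⊗ a_j/a_l + Σ_{i ≠ j} uᵢ ⊗ aᵢ/a_l`).
[cite: Jouanolou1973, Lemme 1.5] -/
theorem invPolyHom_hypVec (i : Fin (N + 1)) :
    invPolyHom ι j X' hX' l (hypVec ι j X' hX' i) = fracInc ι j X' hX' l i := by
  induction i using Fin.succAboveCases j with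
  | x =>
    rw [hypVec_self, map_sub, map_one, map_sum]
    -- `g = 1 ⊗ a_j/a_l + Σ_{i'} (u ⊗ 1)(1 ⊗ a/a_l)`
    have hg0 : incidenceFun ι j l X' hX' =
        (1 : Γ(X.left, (X' : X.left.Opens))) ⊗ₜ[k] Segre.frac k l j +
          ∑ i' : Fin N, (secCoord ι j X' hX' (j.succAbove i') ⊗ₜ[k] (1 : chartBaseRing (k := k) N l)) *
            ((1 : Γ(X.left, (X' : X.left.Opens))) ⊗ₜ[k] Segre.frac k l (j.succAbove i')) := by
      rw [show incidenceFun ι j l X' hX' =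
          ∑ i : Fin (N + 1), secCoord ι j X' hX' i ⊗ₜ[k] Segre.frac k l i from rfl,
        Fin.sum_univ_succAbove _ j, secCoord_self]
      congr 1
      refine Finset.sum_congr rfl fun i' _ ↦ ?_
      rw [Algebra.TensorProduct.tmul_mul_tmul, mul_one, one_mul]
    have hg : algebraMap (chartRing (X := X) l X') (incLocRing ι j X' hX' l) (incidenceFun ι j l X' hX') =
        algebraMap (chartRing (X := X) l X') (incLocRing ι j X' hX' l)
            ((1 : Γ(X.left, (X' : X.left.Opens))) ⊗ₜ[k] Segre.frac k l j) +
          ∑ i' : Fin N, algebraMap (chartRing (X := X) l X') (incLocRing ι j X' hX' l)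
              (secCoord ι j X' hX' (j.succAbove i') ⊗ₜ[k] 1) *
            algebraMap (chartRing (X := X) l X') (incLocRing ι j X' hX' l)
              ((1 : Γ(X.left, (X' : X.left.Opens))) ⊗ₜ[k] Segre.frac k l (j.succAbove i')) := by
      have h := congrArg (algebraMap (chartRing (X := X) l X') (incLocRing ι j X' hX' l)) hg0
      rw [map_add, map_sum] at h
      simp only [map_mul] at h
      exact h
    have hsum : ∑ i' : Fin N, invPolyHom ι j X' hX' l
        (MvPolynomial.C (secCoord ι j X' hX' (j.succAbove i')) * MvPolynomial.X i') =
        (∑ i' : Fin N, algebraMap (chartRing (X := X) l X') (incLocRing ι j X' hX' l) (secCoord ι j X' hX' (j.succAbove i') ⊗ₜ[k] 1) *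
            algebraMap (chartRing (X := X) l X') (incLocRing ι j X' hX' l)
              ((1 : Γ(X.left, (X' : X.left.Opens))) ⊗ₜ[k] Segre.frac k l (j.succAbove i'))) *
          invInc ι j X' hX' l := by
      rw [Finset.sum_mul]
      refine Finset.sum_congr rfl fun i' _ ↦ ?_
      rw [map_mul, invPolyHom_C, invPolyHom_X, fracInc, mul_assoc]
    rw [hsum, fracInc]
    have h1 := algebraMap_incidenceFun_mul_invInc ι j X' hX' l
    rw [hg, add_mul] at h1
    linear_combination -h1
  | p i' => rw [hypVec_succAbove, invPolyHom_X]

/-- `invPolyHom (a_l) = g_l⁻¹` is a unit. [cite: Jouanolou1973, Lemme 1.5] -/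
theorem isUnit_invPolyHom_hypVec : IsUnit (invPolyHom ι j X' hX' l (hypVec ι j X' hX' l)) := by
  rw [invPolyHom_hypVec, fracInc, Segre.frac_self]
  have : ((1 : Γ(X.left, (X' : X.left.Opens))) ⊗ₜ[k] (1 : chartBaseRing (k := k) N l)) = 1 := rfl
  rw [this, map_one, one_mul]
  exact Units.isUnit _

/-- The inverse chart map `B[t][a_l⁻¹] → (B ⊗ R_l)[g_l⁻¹]`. [cite: Jouanolou1973, Lemme 1.5] -/
def invHom : locRing ι j X' hX' l →+* incLocRing ι j X' hX' l :=
  Localization.awayLift (invPolyHom ι j X' hX' l) (hypVec ι j X' hX' l) (isUnit_invPolyHom_hypVec ι j X' hX' l)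

/-- `invHom` extends `invPolyHom`.
[cite: Jouanolou1973, Lemme 1.5] -/
theorem invHom_comp_algebraMap :
    (invHom ι j X' hX' l).comp (algebraMap (chartSrcRing N X') (locRing ι j X' hX' l)) =
      invPolyHom ι j X' hX' l :=
  IsLocalization.Away.lift_comp (hypVec ι j X' hX' l) (isUnit_invPolyHom_hypVec ι j X' hX' l)

/-- `invHom` on the image of `B[t]`.
[cite: Jouanolou1973, Lemme 1.5] -/
@[simp]
theorem invHom_algebraMap (p : chartSrcRing N X') :
    invHom ι j X' hX' l (algebraMap (chartSrcRing N X') (locRing ι j X' hX' l) p) = invPolyHom ι j X' hX' l p :=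
  IsLocalization.Away.lift_eq (hypVec ι j X' hX' l) (isUnit_invPolyHom_hypVec ι j X' hX' l) p

/-- The forward map `(B ⊗ R_l)[g_l⁻¹] → B[t][a_l⁻¹]` extending `ρ_l`. [cite: Jouanolou1973, Lemme 1.5] -/
def fwdHom : incLocRing ι j X' hX' l →+* locRing ι j X' hX' l :=
  Localization.awayLift (chartHom ι j X' hX' l) (incidenceFun ι j l X' hX') (isUnit_chartHom_incidenceFun ι j X' hX' l)

/-- `fwdHom` extends `ρ_l`.
[cite: Jouanolou1973, Lemme 1.5] -/
theorem fwdHom_comp_algebraMap :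
    (fwdHom ι j X' hX' l).comp (algebraMap (chartRing (X := X) l X') (incLocRing ι j X' hX' l)) =
      chartHom ι j X' hX' l :=
  IsLocalization.Away.lift_comp (incidenceFun ι j l X' hX') (isUnit_chartHom_incidenceFun ι j X' hX' l)

/-- `fwdHom` on the image of `B ⊗ R_l`.
[cite: Jouanolou1973, Lemme 1.5] -/
@[simp]
theorem fwdHom_algebraMap (z : chartRing (X := X) l X') :
    fwdHom ι j X' hX' l (algebraMap (chartRing (X := X) l X') (incLocRing ι j X' hX' l) z) = chartHom ι j X' hX' l z :=
  IsLocalization.Away.lift_eq (incidenceFun ι j l X' hX') (isUnit_chartHom_incidenceFun ι j X' hX' l) z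

/-- `fwdHom (g_l⁻¹) = a_l`.
[cite: Jouanolou1973, Lemme 1.5] -/
theorem fwdHom_invInc :
    fwdHom ι j X' hX' l (invInc ι j X' hX' l) =
      algebraMap (chartSrcRing N X') (locRing ι j X' hX' l) (hypVec ι j X' hX' l) := by
  have h1 : fwdHom ι j X' hX' l (algebraMap (chartRing (X := X) l X') (incLocRing ι j X' hX' l)
      (incidenceFun ι j l X' hX')) * fwdHom ι j X' hX' l (invInc ι j X' hX' l) = 1 := by
    rw [← map_mul, algebraMap_incidenceFun_mul_invInc, map_one]
  rw [fwdHom_algebraMap, chartHom_incidenceFun] at h1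
  calc fwdHom ι j X' hX' l (invInc ι j X' hX' l)
      = (algebraMap (chartSrcRing N X') (locRing ι j X' hX' l) (hypVec ι j X' hX' l) * invHyp ι j X' hX' l) *
          fwdHom ι j X' hX' l (invInc ι j X' hX' l) := by rw [algebraMap_hypVec_mul_invHyp, one_mul]
    _ = algebraMap (chartSrcRing N X') (locRing ι j X' hX' l) (hypVec ι j X' hX' l) := by
          rw [mul_assoc, h1, mul_one]

/-- `fwdHom ((1 ⊗ aᵢ/a_l) g⁻¹) = aᵢ`. [cite: Jouanolou1973, Lemme 1.5] -/
theorem fwdHom_fracInc (i : Fin (N + 1)) :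
    fwdHom ι j X' hX' l (fracInc ι j X' hX' l i) =
      algebraMap (chartSrcRing N X') (locRing ι j X' hX' l) (hypVec ι j X' hX' i) := by
  rw [fracInc, map_mul, fwdHom_algebraMap, chartHom_tmul, map_one, map_one, one_mul, dualChartHom_frac,
    fwdHom_invInc, mul_assoc, invHyp_mul_algebraMap_hypVec, mul_one]

/-- `invHom (a_l⁻¹) = g_l`.
[cite: Jouanolou1973, Lemme 1.5] -/
theorem invHom_invHyp :
    invHom ι j X' hX' l (invHyp ι j X' hX' l) =
      algebraMap (chartRing (X := X) l X') (incLocRing ι j X' hX' l) (incidenceFun ι j l X' hX') := by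
  have h1 : invHom ι j X' hX' l (algebraMap (chartSrcRing N X') (locRing ι j X' hX' l) (hypVec ι j X' hX' l)) *
      invHom ι j X' hX' l (invHyp ι j X' hX' l) = 1 := by
    rw [← map_mul, algebraMap_hypVec_mul_invHyp, map_one]
  rw [invHom_algebraMap, invPolyHom_hypVec, fracInc, Segre.frac_self] at h1
  have h11 : ((1 : Γ(X.left, (X' : X.left.Opens))) ⊗ₜ[k] (1 : chartBaseRing (k := k) N l)) = 1 := rfl
  rw [h11, map_one, one_mul] at h1
  calc invHom ι j X' hX' l (invHyp ι j X' hX' l)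
      = (algebraMap (chartRing (X := X) l X') (incLocRing ι j X' hX' l) (incidenceFun ι j l X' hX') *
          invInc ι j X' hX' l) * invHom ι j X' hX' l (invHyp ι j X' hX' l) := by
            rw [algebraMap_incidenceFun_mul_invInc, one_mul]
    _ = _ := by rw [mul_assoc, h1, mul_one]

/-- `invHom ∘ ρ_l` restricted to `B`: `b ⊗ 1 ↦ b ⊗ 1`.
[cite: Jouanolou1973, Lemme 1.5] -/
theorem invHom_chartHom_includeLeft (b : Γ(X.left, (X' : X.left.Opens))) :
    invHom ι j X' hX' l (chartHom ι j X' hX' l (b ⊗ₜ[k] 1)) =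
      algebraMap (chartRing (X := X) l X') (incLocRing ι j X' hX' l) (b ⊗ₜ[k] 1) := by
  rw [chartHom_tmul, map_one, mul_one, invHom_algebraMap, invPolyHom_C]

/-- `invHom ∘ ρ_l` restricted to `(k[a]_{(a_l)})₀`: `1 ⊗ r ↦ 1 ⊗ r`.
[cite: Jouanolou1973, Lemme 1.5] -/
theorem invHom_comp_chartHom_comp_includeRight :
    ((invHom ι j X' hX' l).comp (chartHom ι j X' hX' l)).comp
        (Algebra.TensorProduct.includeRight (R := k) (A := Γ(X.left, (X' : X.left.Opens)))
          (B := chartBaseRing (k := k) N l)).toRingHom =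
      (algebraMap (chartRing (X := X) l X') (incLocRing ι j X' hX' l)).comp
        (Algebra.TensorProduct.includeRight (R := k) (A := Γ(X.left, (X' : X.left.Opens)))
          (B := chartBaseRing (k := k) N l)).toRingHom := by
  refine Segre.ringHom_ext_away k l ?_ fun i ↦ ?_
  · ext c
    simp only [RingHom.comp_apply, AlgHom.toRingHom_eq_coe, RingHom.coe_coe,
      Algebra.TensorProduct.includeRight_apply, chartHom_tmul, map_one, one_mul, dualChartHom_cst]
    rw [IsScalarTower.algebraMap_apply k Γ(X.left, (X' : X.left.Opens)) (locRing ι j X' hX' l),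
      IsScalarTower.algebraMap_apply Γ(X.left, (X' : X.left.Opens)) (chartSrcRing N X') (locRing ι j X' hX' l),
      MvPolynomial.algebraMap_eq, invHom_algebraMap, invPolyHom_C, ← Algebra.TensorProduct.algebraMap_apply]
    change _ = algebraMap (chartRing (X := X) l X') (incLocRing ι j X' hX' l)
      ((1 : Γ(X.left, (X' : X.left.Opens))) ⊗ₜ[k] algebraMap k (chartBaseRing (k := k) N l) c)
    rw [← Algebra.TensorProduct.algebraMap_apply']
  · simp only [RingHom.comp_apply, AlgHom.toRingHom_eq_coe, RingHom.coe_coe,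
      Algebra.TensorProduct.includeRight_apply, chartHom_tmul, map_one, one_mul, dualChartHom_frac, map_mul,
      invHom_algebraMap, invPolyHom_hypVec, invHom_invHyp, fracInc, mul_assoc,
      invInc_mul_algebraMap_incidenceFun, mul_one]

/-- `invHom ∘ fwdHom = id` on `(B ⊗ R_l)[g_l⁻¹]`. [cite: Jouanolou1973, Lemme 1.5] -/
theorem invHom_comp_fwdHom :
    (invHom ι j X' hX' l).comp (fwdHom ι j X' hX' l) = RingHom.id (incLocRing ι j X' hX' l) := by
  apply IsLocalization.ringHom_ext (Submonoid.powers (incidenceFun ι j l X' hX'))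
  rw [RingHom.comp_assoc, fwdHom_comp_algebraMap, RingHom.id_comp]
  refine Algebra.TensorProduct.ringHom_ext ?_ (invHom_comp_chartHom_comp_includeRight ι j X' hX' l)
  ext b
  simp only [RingHom.comp_apply, Algebra.TensorProduct.includeLeftRingHom_apply]
  exact invHom_chartHom_includeLeft ι j X' hX' l b

/-- `fwdHom ∘ invHom = id` on `B[t][a_l⁻¹]`. [cite: Jouanolou1973, Lemme 1.5] -/
theorem fwdHom_comp_invHom :
    (fwdHom ι j X' hX' l).comp (invHom ι j X' hX' l) = RingHom.id (locRing ι j X' hX' l) := by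
  apply IsLocalization.ringHom_ext (Submonoid.powers (hypVec ι j X' hX' l))
  rw [RingHom.comp_assoc, invHom_comp_algebraMap, RingHom.id_comp]
  refine MvPolynomial.ringHom_ext (fun b ↦ ?_) (fun i' ↦ ?_)
  · rw [RingHom.comp_apply, invPolyHom_C, fwdHom_algebraMap, chartHom_tmul, map_one, mul_one]
  · rw [RingHom.comp_apply, invPolyHom_X, fwdHom_fracInc, hypVec_succAbove]

/-- **The chart isomorphism of rings** `(B ⊗ₖ (k[a]_{(a_l)})₀)[g_l⁻¹] ≅ B[t][a_l⁻¹]`: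
`π⁻¹X' ∩ (X' × D₊(a_l)) ≅ {a_l ≠ 0} ⊆ X' × 𝔸ᴺ` — Jouanolou's torsor is trivial over `X'`.
[cite: Jouanolou1973, Lemme 1.5] -/
def locEquiv : incLocRing ι j X' hX' l ≃+* locRing ι j X' hX' l :=
  RingEquiv.ofRingHom (fwdHom ι j X' hX' l) (invHom ι j X' hX' l)
    (fwdHom_comp_invHom ι j X' hX' l) (invHom_comp_fwdHom ι j X' hX' l)

/-- `locEquiv` is `fwdHom` on elements.
[cite: Jouanolou1973, Lemme 1.5] -/
@[simp]
theorem locEquiv_apply (z : incLocRing ι j X' hX' l) : locEquiv ι j X' hX' l z = fwdHom ι j X' hX' l z := rfl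

/-- `locEquiv` restricted to `B ⊗ R_l` is `ρ_l`: **`ρ_l` is the localisation of `B ⊗ R_l` at `g_l`.**
[cite: Jouanolou1973, Lemme 1.5] -/
theorem locEquiv_comp_algebraMap :
    (locEquiv ι j X' hX' l).toRingHom.comp (algebraMap (chartRing (X := X) l X') (incLocRing ι j X' hX' l)) =
      chartHom ι j X' hX' l :=
  fwdHom_comp_algebraMap ι j X' hX' l

/-- Elementwise form of `locEquiv_comp_algebraMap`. [cite: Jouanolou1973, Lemme 1.5] -/
theorem locEquiv_algebraMap (z : chartRing (X := X) l X') :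
    locEquiv ι j X' hX' l (algebraMap (chartRing (X := X) l X') (incLocRing ι j X' hX' l) z) =
      chartHom ι j X' hX' l z :=
  fwdHom_algebraMap ι j X' hX' l z

/-- `B[t][a_l⁻¹]` is the localisation of `B ⊗ₖ (k[a]_{(a_l)})₀` at `g_l` along `ρ_l`.
[cite: Jouanolou1973, Lemme 1.5] -/
theorem isLocalization_away_chartHom :
    @IsLocalization.Away (chartRing (X := X) l X') _ (incidenceFun ι j l X' hX') (locRing ι j X' hX' l) _
      (chartHom ι j X' hX' l).toAlgebra := by
  letI : Algebra (chartRing (X := X) l X') (locRing ι j X' hX' l) := (chartHom ι j X' hX' l).toAlgebra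
  refine IsLocalization.isLocalization_of_algEquiv (Submonoid.powers (incidenceFun ι j l X' hX'))
    { locEquiv ι j X' hX' l with
      commutes' := fun z ↦ ?_ }
  exact locEquiv_algebraMap ι j X' hX' l z

end Loc

end JouanolouTorsor

end Literature.AlgebraicGeometry.Motives

end
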